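import Mathlib
import HarnessLib
import Summits.HubbardSuperconductivity.HubbardSuperconductivity.Theorems.KLProgrammeC4aFirstOrderTubePiece
import Summits.HubbardSuperconductivity.HubbardSuperconductivity.Theorems.KLProgrammeC4aPathJets

/-!
# Route `KLProgramme` — crux C4a, S3 brick (B4) «(U1)-HYBRID» B-1 (xii): the FIRST-ORDER co-moving jet of the tube piece for a kernel family with ONLY the
# regularity the laws read — `C²` in the partner level per loop level, JOINT CONTINUITY of `K` and `∂ᵤK` — and a merely continuous level weight

Cell `gate-hubbard-kl`, seat hubbard-kl-k3c3-p3 (g38; row «implicit-function / monotonicity route for μ(n)»).  Located brick for the (C)-closer lane / the `M₁` assembly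
(stub (C) `stub_twoLeg_curvature` of `KLRegimeEngineV17F2`, stmt-HubbardSuperconductivity-20437), memo HOME/hubbard-kl-k3c3-p3/SWAP-BY-SYMMETRY.md §4 (honest scope).

WHY.  B-1 (xi) `…C4aFirstOrderTubePieceFamily.iteratedDeriv_one_tubePiece_eq₂` (✓ p737047) runs the all-orders machinery of (B3) and therefore asks the kernel family to be
JOINTLY `C^∞` (`ContDiff ℝ ∞ fun p => K p.1 p.2`) and the level weight to be `C^∞` with compact support.  The concrete families of the symmetric organisation
(`χ(u)·A_s(e,u)`, `χ(u)·M_s(e,u)`, `(1−χ(u))·P(e,u)`; `…C4aBubbleSwapSymmetry`, `…C4aKernelBumpRows`) come with `C^N` in `u` for each `e` (`contDiff_ppTrueKernel_u`), joint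
continuity of `K` (`continuous_ppTrueKernel_comp`) and of `∂ᵤK` (`continuous_deriv_ppFarKernelS₂`, U7's row `hKc`) — not with joint smoothness.  At ORDER ONE nothing
more is needed: per level line B-1 (vii)/(x) (`hasDerivAt_loopIntegral_pp_abs`, `C²` in `u` with global bounds), and across levels ONE dominated-convergence step
(`intervalIntegral.hasDerivAt_integral_of_dominated_loc_of_deriv_le`) whose measurability inputs are continuity in the loop level (the clamp device of
`…C4aFirstOrderLayerSum.continuousOn_level_lineIntegral`) and whose dominator is the constant `W·2π·J₀·(2K₁msD₁)·M₁`.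
* `continuousOn_loopIntegral_pp_level` — `e ↦ ∫_{(−π,π)} J(e,φ+θ)·K e(ē) dφ` is continuous on `[−hi, hi]`;
* `continuousOn_firstOrderLine_level` — `e ↦ ∫_{−π}^{π} J(e,v+θ)·G·(K e)′(ē) dv` is continuous on `[−hi, hi]`;
* `hasDerivAt_loopIntegral_pp_real` — per level, `HasDerivAt (θ ↦ ∫ J•K e(ē)) ((∫ J·G·(K e)′(ē) : ℝ) : ℂ) θ`;
* **`hasDerivAt_tubePiece_joint`** (HEADLINE) — for `f` continuous and bounded on `[−hi,hi]`, `0 ≤ hi < r`, `K e ∈ C²` with `|K| ≤ M₀`, `|∂ᵤK| ≤ M₁` on the box, `K`, `∂ᵤK`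
  jointly continuous:  `HasDerivAt (θ ↦ ∫_{−hi}^{hi} f(e)·(∫_{(−π,π)} J(e,φ+θ)•K e(ē) dφ) de) ((∫_{−hi}^{hi} f ∫_{−π}^{π} J·G·(K e)′(ē) : ℝ) : ℂ) θ₀`;
* **`norm_deriv_tubePiece_joint_eq`** — `‖∂_θ(tube piece)‖ = |∫_{−hi}^{hi} f ∫ J·G·(K e)′(ē)|` = the left-hand side of `firstOrderLayer_abs_le` / `farPartner_firstOrderLayer_abs_le`.
Sizes binder shape of B-1 (vii)/(x); nothing asserts (C), K3, the window or superconductivity.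
References: BGM 2006 §2.4 (2.40) [cite: BenfattoGiulianiMastropietro2006]; FST II CPAM 51 (1998) §3 [cite: FeldmanSalmhoferTrubowitz1998]; Hörmander ALPDO I Thm 1.1.8.
-/

noncomputable section

namespace Summit.HubbardSuperconductivity.HubbardSuperconductivity.Theorems.C4a

set_option linter.dupNamespace false -- summit = problem name (single-conjunct summit), D-0017

open Real Set Filter MeasureTheory intervalIntegral Metric
open scoped Topology Interval
open Literature.MathematicalPhysics.QuantumLattice Literature.MathematicalPhysics.QuantumLattice.BandSectorCounting Literature.Probability.LatticeModels
open Summit.HubbardSuperconductivity.HubbardSuperconductivity.Theorems.KLRegimeSplit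
open Summit.HubbardSuperconductivity.HubbardSuperconductivity.Theorems.DispersionFlow
open Summit.HubbardSuperconductivity.HubbardSuperconductivity.Theorems.PerturbedFermiCurve

section Sizes

variable {K : TrigPolyC4v} {A : ℝ} (hA : ∀ p : Momentum, ∀ j ≤ 2, ‖iteratedFDeriv ℝ j (frameShift K) p‖ ≤ A) (hA20 : A ≤ 1 / 20)
  (hd : klCurveD ≤ (bandBounds (show (-4 : ℝ) < -1.1 by norm_num) (show (-1.1 : ℝ) ≤ -0.1 by norm_num)
    (show (-0.1 : ℝ) < 0 by norm_num)).Dtmin - 2 * A)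
  {μ r : ℝ} (hr : 0 < r) (hlo : (-1.1 : ℝ) < μ - r - A) (hhi : μ + r + A < -0.1)
  {A₃ A₄ : ℝ} (hA₃ : ∀ p : Momentum, ‖iteratedFDeriv ℝ 3 (frameShift K) p‖ ≤ A₃)
  (hA₄ : ∀ p : Momentum, ‖iteratedFDeriv ℝ 4 (frameShift K) p‖ ≤ A₄)
  {K₁ : ℝ} (hK₁ : ∀ p : Momentum, ‖fderiv ℝ (frameLevel μ K) p‖ ≤ K₁)
include hA hA20 hd hr hlo hhi hA₃ hA₄ hK₁

/-! ## §1 Continuity in the loop level (the clamp device) -/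

omit hA20 hr hA₃ hA₄ hK₁ in
/-- **`e ↦ ∫_{(−π,π)} J(e,φ+θ)·K e(ē(e,φ;θ)) dφ` is continuous on `[−hi, hi]`** (`0 ≤ hi < r`, `K` jointly continuous). -/
theorem continuousOn_loopIntegral_pp_level {ρ : ℝ} (ϑ θ : ℝ) {hi : ℝ} (hhi0 : 0 ≤ hi) (hhir : hi < r) {Kr : ℝ → ℝ → ℝ}
    (hKc0 : Continuous fun p : ℝ × ℝ => Kr p.1 p.2) :
    ContinuousOn (fun e : ℝ => ∫ φ in Ioo (-π) π, (levelChartJac μ K (e, φ + θ) : ℝ) •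
      ((Kr e (frameLevel μ K (levelPoint μ K 0 θ + levelPoint μ K ρ (ϑ + θ) - levelPoint μ K e (φ + θ))) : ℝ) : ℂ)) (Icc (-hi) hi) := by
  set B := bandBounds (show (-4 : ℝ) < -1.1 by norm_num) (show (-1.1 : ℝ) ≤ -0.1 by norm_num) (show (-0.1 : ℝ) < 0 by norm_num) with hBdef
  have hADt : 2 * A < B.Dtmin := by have := klCurveD_pos; linarith only [this, hd]
  have hlev : ContinuousOn (fun p : ℝ × ℝ => levelPoint μ K p.1 p.2) ({x : ℝ | |x| < r} ×ˢ univ) :=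
    (contDiffOn_levelPoint B hA hADt hlo hhi (m := 0)).continuousOn
  have hjac : ContinuousOn (levelChartJac μ K) ({x : ℝ | |x| < r} ×ˢ univ) := (contDiffOn_levelChartJac B hA hADt hlo hhi).continuousOn
  have hfl : Continuous (frameLevel μ K) := (EngineV8.contDiff_frameLevel μ K (n := 0)).continuous
  have hhh : -hi ≤ hi := by linarith only [hhi0]
  have hcl : Continuous fun p : ℝ × ℝ => max (-hi) (min p.1 hi) := continuous_const.max ((continuous_fst).min continuous_const)
  have hclI : ∀ p : ℝ × ℝ, max (-hi) (min p.1 hi) ∈ Icc (-hi) hi := fun p => ⟨le_max_left _ _, max_le hhh (min_le_right _ _)⟩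
  have hclr : ∀ p : ℝ × ℝ, |max (-hi) (min p.1 hi)| < r := fun p =>
    abs_lt.2 ⟨by linarith only [(hclI p).1, hhir], lt_of_le_of_lt (hclI p).2 hhir⟩
  have hL := hlev.comp_continuous (f := fun p : ℝ × ℝ => ((max (-hi) (min p.1 hi), p.2 + θ) : ℝ × ℝ))
    (hcl.prodMk (continuous_snd.add continuous_const)) fun p => mem_prod.2 ⟨hclr p, mem_univ _⟩
  have hL' : Continuous fun p : ℝ × ℝ => levelPoint μ K (max (-hi) (min p.1 hi)) (p.2 + θ) := hL.congr fun _ => rfl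
  have hJ := hjac.comp_continuous (f := fun p : ℝ × ℝ => ((max (-hi) (min p.1 hi), p.2 + θ) : ℝ × ℝ))
    (hcl.prodMk (continuous_snd.add continuous_const)) fun p => mem_prod.2 ⟨hclr p, mem_univ _⟩
  have hJ' : Continuous fun p : ℝ × ℝ => levelChartJac μ K (max (-hi) (min p.1 hi), p.2 + θ) := hJ.congr fun _ => rfl
  have hband : Continuous fun p : ℝ × ℝ =>
      frameLevel μ K (levelPoint μ K 0 θ + levelPoint μ K ρ (ϑ + θ) - levelPoint μ K (max (-hi) (min p.1 hi)) (p.2 + θ)) :=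
    hfl.comp (continuous_const.sub hL')
  have hKcl : Continuous fun p : ℝ × ℝ => Kr (max (-hi) (min p.1 hi))
      (frameLevel μ K (levelPoint μ K 0 θ + levelPoint μ K ρ (ϑ + θ) - levelPoint μ K (max (-hi) (min p.1 hi)) (p.2 + θ))) :=
    (hKc0.comp (hcl.prodMk hband)).congr fun _ => rfl
  have hG : Continuous (Function.uncurry fun e φ => (levelChartJac μ K (max (-hi) (min e hi), φ + θ) : ℝ) •
      ((Kr (max (-hi) (min e hi))
        (frameLevel μ K (levelPoint μ K 0 θ + levelPoint μ K ρ (ϑ + θ) - levelPoint μ K (max (-hi) (min e hi)) (φ + θ))) : ℝ) : ℂ)) :=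
    hJ'.smul (Complex.continuous_ofReal.comp hKcl)
  have hcont := intervalIntegral.continuous_parametric_intervalIntegral_of_continuous' (μ := volume) hG (-π) π
  refine (hcont.continuousOn (s := Icc (-hi) hi)).congr fun e he => ?_
  have hce : max (-hi) (min e hi) = e := by rw [min_eq_left he.2, max_eq_right he.1]
  simp only [hce]
  rw [intervalIntegral.integral_of_le (by linarith [pi_pos]), integral_Ioc_eq_integral_Ioo]

omit hA20 hr hA₃ hA₄ hK₁ in
/-- **`e ↦ ∫_{−π}^{π} J(e,v+θ)·G(θ,e,v)·(K e)′(ē) dv` is continuous on `[−hi, hi]`** (`∂ᵤK` jointly continuous). -/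
theorem continuousOn_firstOrderLine_level {ρ : ℝ} (ϑ θ : ℝ) {hi : ℝ} (hhi0 : 0 ≤ hi) (hhir : hi < r) {Kr : ℝ → ℝ → ℝ}
    (hKc : Continuous fun p : ℝ × ℝ => deriv (Kr p.1) p.2) :
    ContinuousOn (fun e : ℝ => ∫ v in (-π)..π, levelChartJac μ K (e, v + θ) *
        (fderiv ℝ (frameLevel μ K) (pairSumPath μ K ρ ϑ θ 0 - levelPoint μ K e (v + θ)))
          (iteratedDeriv 1 (levelPoint μ K 0) θ + iteratedDeriv 1 (levelPoint μ K ρ) (ϑ + θ)) *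
        deriv (Kr e) (frameLevel μ K (pairSumPath μ K ρ ϑ θ 0 - levelPoint μ K e (v + θ)))) (Icc (-hi) hi) := by
  set B := bandBounds (show (-4 : ℝ) < -1.1 by norm_num) (show (-1.1 : ℝ) ≤ -0.1 by norm_num) (show (-0.1 : ℝ) < 0 by norm_num) with hBdef
  have hADt : 2 * A < B.Dtmin := by have := klCurveD_pos; linarith only [this, hd]
  have hlev : ContinuousOn (fun p : ℝ × ℝ => levelPoint μ K p.1 p.2) ({x : ℝ | |x| < r} ×ˢ univ) :=
    (contDiffOn_levelPoint B hA hADt hlo hhi (m := 0)).continuousOn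
  have hjac : ContinuousOn (levelChartJac μ K) ({x : ℝ | |x| < r} ×ˢ univ) := (contDiffOn_levelChartJac B hA hADt hlo hhi).continuousOn
  have hfl : Continuous (frameLevel μ K) := (EngineV8.contDiff_frameLevel μ K (n := 0)).continuous
  have hDfl : Continuous (fderiv ℝ (frameLevel μ K)) := (EngineV8.contDiff_frameLevel μ K (n := 1)).continuous_fderiv one_ne_zero
  have hhh : -hi ≤ hi := by linarith only [hhi0]
  have hcl : Continuous fun p : ℝ × ℝ => max (-hi) (min p.1 hi) := continuous_const.max ((continuous_fst).min continuous_const)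
  have hclI : ∀ p : ℝ × ℝ, max (-hi) (min p.1 hi) ∈ Icc (-hi) hi := fun p => ⟨le_max_left _ _, max_le hhh (min_le_right _ _)⟩
  have hclr : ∀ p : ℝ × ℝ, |max (-hi) (min p.1 hi)| < r := fun p =>
    abs_lt.2 ⟨by linarith only [(hclI p).1, hhir], lt_of_le_of_lt (hclI p).2 hhir⟩
  have hL := hlev.comp_continuous (f := fun p : ℝ × ℝ => ((max (-hi) (min p.1 hi), p.2 + θ) : ℝ × ℝ))
    (hcl.prodMk (continuous_snd.add continuous_const)) fun p => mem_prod.2 ⟨hclr p, mem_univ _⟩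
  have hL' : Continuous fun p : ℝ × ℝ => levelPoint μ K (max (-hi) (min p.1 hi)) (p.2 + θ) := hL.congr fun _ => rfl
  have hJ := hjac.comp_continuous (f := fun p : ℝ × ℝ => ((max (-hi) (min p.1 hi), p.2 + θ) : ℝ × ℝ))
    (hcl.prodMk (continuous_snd.add continuous_const)) fun p => mem_prod.2 ⟨hclr p, mem_univ _⟩
  have hJ' : Continuous fun p : ℝ × ℝ => levelChartJac μ K (max (-hi) (min p.1 hi), p.2 + θ) := hJ.congr fun _ => rfl
  have harg : Continuous fun p : ℝ × ℝ => pairSumPath μ K ρ ϑ θ 0 - levelPoint μ K (max (-hi) (min p.1 hi)) (p.2 + θ) :=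
    continuous_const.sub hL'
  have hband : Continuous fun p : ℝ × ℝ => frameLevel μ K (pairSumPath μ K ρ ϑ θ 0 - levelPoint μ K (max (-hi) (min p.1 hi)) (p.2 + θ)) :=
    hfl.comp harg
  have hGf : Continuous fun p : ℝ × ℝ => (fderiv ℝ (frameLevel μ K) (pairSumPath μ K ρ ϑ θ 0 - levelPoint μ K (max (-hi) (min p.1 hi)) (p.2 + θ)))
      (iteratedDeriv 1 (levelPoint μ K 0) θ + iteratedDeriv 1 (levelPoint μ K ρ) (ϑ + θ)) :=
    (hDfl.comp harg).clm_apply continuous_const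
  have hKcl : Continuous fun p : ℝ × ℝ => deriv (Kr (max (-hi) (min p.1 hi)))
      (frameLevel μ K (pairSumPath μ K ρ ϑ θ 0 - levelPoint μ K (max (-hi) (min p.1 hi)) (p.2 + θ))) :=
    (hKc.comp (hcl.prodMk hband)).congr fun _ => rfl
  have hG : Continuous (Function.uncurry fun e v => levelChartJac μ K (max (-hi) (min e hi), v + θ) *
      (fderiv ℝ (frameLevel μ K) (pairSumPath μ K ρ ϑ θ 0 - levelPoint μ K (max (-hi) (min e hi)) (v + θ)))
        (iteratedDeriv 1 (levelPoint μ K 0) θ + iteratedDeriv 1 (levelPoint μ K ρ) (ϑ + θ)) *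
      deriv (Kr (max (-hi) (min e hi))) (frameLevel μ K (pairSumPath μ K ρ ϑ θ 0 - levelPoint μ K (max (-hi) (min e hi)) (v + θ)))) :=
    (hJ'.mul hGf).mul hKcl
  have hcont := intervalIntegral.continuous_parametric_intervalIntegral_of_continuous' (μ := volume) hG (-π) π
  refine (hcont.continuousOn (s := Icc (-hi) hi)).congr fun e he => ?_
  have hce : max (-hi) (min e hi) = e := by rw [min_eq_left he.2, max_eq_right he.1]
  simp only [hce]

/-! ## §2 Per level: the derivative of the loop integral as a real level line -/

/-- **Per level line, real kernel**: `HasDerivAt (θ ↦ ∫_{(−π,π)} J(e,φ+θ)•K e(ē) dφ) ((∫_{−π}^{π} J·G·(K e)′(ē) : ℝ) : ℂ) θ₀` for `K e ∈ C²` with global bounds, `|e|, |ρ| < r`. -/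
theorem hasDerivAt_loopIntegral_pp_real {Kr : ℝ → ℝ} (hK : ContDiff ℝ 2 Kr) {M₀ M₁ : ℝ} (hK0 : ∀ x, |Kr x| ≤ M₀) (hK1 : ∀ x, |deriv Kr x| ≤ M₁)
    {ρ e : ℝ} (hρ : |ρ| < r) (he : |e| < r) (ϑ θ₀ : ℝ) :
    HasDerivAt (fun θ : ℝ => ∫ φ in Ioo (-π) π,
        (levelChartJac μ K (e, φ + θ) : ℝ) • ((Kr (frameLevel μ K (levelPoint μ K 0 θ + levelPoint μ K ρ (ϑ + θ) - levelPoint μ K e (φ + θ))) : ℝ) : ℂ))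
      (((∫ v in (-π)..π, levelChartJac μ K (e, v + θ₀) *
          (fderiv ℝ (frameLevel μ K) (pairSumPath μ K ρ ϑ θ₀ 0 - levelPoint μ K e (v + θ₀)))
            (iteratedDeriv 1 (levelPoint μ K 0) θ₀ + iteratedDeriv 1 (levelPoint μ K ρ) (ϑ + θ₀)) *
        deriv Kr (frameLevel μ K (pairSumPath μ K ρ ϑ θ₀ 0 - levelPoint μ K e (v + θ₀))) : ℝ) : ℂ)) θ₀ := by
  set Ψ : ℝ → ℂ := fun u => ((Kr u : ℝ) : ℂ) with hΨdef
  have hΨ : ContDiff ℝ 2 Ψ := Complex.ofRealCLM.contDiff.comp hK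
  have hΨ0 : ∀ x, ‖Ψ x‖ ≤ M₀ := fun x => by simp only [hΨdef, Complex.norm_real, Real.norm_eq_abs]; exact hK0 x
  have hΨ' : ∀ u, deriv Ψ u = ((deriv Kr u : ℝ) : ℂ) := fun u => (((hK.differentiable (by norm_num)) u).hasDerivAt.ofReal_comp).deriv
  have hΨ1 : ∀ x, ‖deriv Ψ x‖ ≤ M₁ := fun x => by rw [hΨ' x, Complex.norm_real, Real.norm_eq_abs]; exact hK1 x
  have h := hasDerivAt_loopIntegral_pp_abs hA hA20 hd hr hlo hhi hA₃ hA₄ hK₁ hΨ hΨ0 hΨ1 hρ he ϑ θ₀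
  have hval := loopIntegral_firstOrder_ofReal hA hA20 hd hr hlo hhi hA₃ hA₄ hK₁ hK hK0 hK1 hρ he ϑ θ₀
  rw [h.deriv] at hval
  rw [← hval]
  exact h

/-! ## §3 The tube piece: one dominated-convergence step across the levels -/

/-- **THE FIRST-ORDER CO-MOVING JET OF THE TUBE PIECE — JOINT `C⁰` KERNEL DATA** (HEADLINE): `f` continuous with `|f| ≤ W` on `[−hi,hi]`, `0 ≤ hi < r`;
`K e ∈ C²` for `e ∈ [−hi,hi]` with `|K e u| ≤ M₀`, `|∂ᵤK e u| ≤ M₁`; `K` and `∂ᵤK` jointly continuous; `|ρ| < r`.  Then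
`HasDerivAt (θ ↦ ∫_{−hi}^{hi} f(e)·(∫_{(−π,π)} J(e,φ+θ)•K e(ē) dφ) de) ((∫_{−hi}^{hi} f(e)·(∫_{−π}^{π} J(e,v+θ₀)·G·(K e)′(ē) dv) de : ℝ) : ℂ) θ₀`.
[cite: BenfattoGiulianiMastropietro2006, §2.4 (2.40)] -/
theorem hasDerivAt_tubePiece_joint {f : ℝ → ℝ} {hi W : ℝ} (hhi0 : 0 ≤ hi) (hhir : hi < r) (hfc : ContinuousOn f (Icc (-hi) hi))
    (hfW : ∀ e ∈ Icc (-hi) hi, |f e| ≤ W)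
    {Kr : ℝ → ℝ → ℝ} (hKd : ∀ e ∈ Icc (-hi) hi, ContDiff ℝ 2 (Kr e)) (hKc0 : Continuous fun p : ℝ × ℝ => Kr p.1 p.2)
    (hKc : Continuous fun p : ℝ × ℝ => deriv (Kr p.1) p.2) {M₀ M₁ : ℝ} (hK0 : ∀ e ∈ Icc (-hi) hi, ∀ u, |Kr e u| ≤ M₀)
    (hK1 : ∀ e ∈ Icc (-hi) hi, ∀ u, |deriv (Kr e) u| ≤ M₁) {ρ : ℝ} (hρ : |ρ| < r) (ϑ θ₀ : ℝ) :
    HasDerivAt (fun θ : ℝ => ∫ e in (-hi)..hi, ((f e : ℝ) : ℂ) * ∫ φ in Ioo (-π) π,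
        (levelChartJac μ K (e, φ + θ) : ℝ) • ((Kr e (frameLevel μ K (levelPoint μ K 0 θ + levelPoint μ K ρ (ϑ + θ) - levelPoint μ K e (φ + θ))) : ℝ) : ℂ))
      (((∫ e in (-hi)..hi, f e * ∫ v in (-π)..π, levelChartJac μ K (e, v + θ₀) *
          (fderiv ℝ (frameLevel μ K) (pairSumPath μ K ρ ϑ θ₀ 0 - levelPoint μ K e (v + θ₀)))
            (iteratedDeriv 1 (levelPoint μ K 0) θ₀ + iteratedDeriv 1 (levelPoint μ K ρ) (ϑ + θ₀)) *
        deriv (Kr e) (frameLevel μ K (pairSumPath μ K ρ ϑ θ₀ 0 - levelPoint μ K e (v + θ₀))) : ℝ) : ℂ)) θ₀ := by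
  set B₀ := bandBounds (show (-4 : ℝ) < -1.1 by norm_num) (show (-1.1 : ℝ) ≤ -0.1 by norm_num) (show (-0.1 : ℝ) < 0 by norm_num) with hB₀
  have hADt : 2 * A < B₀.Dtmin := by have := klCurveD_pos; linarith only [this, hd]
  have hhh : -hi ≤ hi := by linarith only [hhi0]
  have hIcc_r : ∀ e ∈ Icc (-hi) hi, |e| < r := fun e he => abs_lt.2 ⟨by linarith [he.1], lt_of_le_of_lt he.2 hhir⟩
  have h0r : |(0 : ℝ)| < r := by rw [abs_zero]; exact hr
  -- the two families
  set F : ℝ → ℝ → ℂ := fun θ e => ((f e : ℝ) : ℂ) * ∫ φ in Ioo (-π) π,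
      (levelChartJac μ K (e, φ + θ) : ℝ) • ((Kr e (frameLevel μ K (levelPoint μ K 0 θ + levelPoint μ K ρ (ϑ + θ) - levelPoint μ K e (φ + θ))) : ℝ) : ℂ)
    with hFdef
  set L : ℝ → ℝ → ℝ := fun θ e => ∫ v in (-π)..π, levelChartJac μ K (e, v + θ) *
      (fderiv ℝ (frameLevel μ K) (pairSumPath μ K ρ ϑ θ 0 - levelPoint μ K e (v + θ)))
        (iteratedDeriv 1 (levelPoint μ K 0) θ + iteratedDeriv 1 (levelPoint μ K ρ) (ϑ + θ)) *
      deriv (Kr e) (frameLevel μ K (pairSumPath μ K ρ ϑ θ 0 - levelPoint μ K e (v + θ))) with hLdef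
  set F' : ℝ → ℝ → ℂ := fun θ e => ((f e : ℝ) : ℂ) * ((L θ e : ℝ) : ℂ) with hF'def
  -- per-level differentiability
  have h_diff : ∀ᵐ e ∂volume, e ∈ Ι (-hi) hi → ∀ θ ∈ (univ : Set ℝ), HasDerivAt (fun θ => F θ e) (F' θ e) θ := by
    refine Eventually.of_forall fun e he θ _ => ?_
    have he' : e ∈ Icc (-hi) hi := by rw [uIoc_of_le hhh] at he; exact ⟨he.1.le, he.2⟩
    have hline := hasDerivAt_loopIntegral_pp_real hA hA20 hd hr hlo hhi hA₃ hA₄ hK₁ (hKd e he') (hK0 e he') (hK1 e he') hρ (hIcc_r e he') ϑ θ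
    exact hline.const_mul _
  -- continuity in the level ⇒ measurability
  have hFcont : ∀ θ, ContinuousOn (fun e => F θ e) (Icc (-hi) hi) := fun θ =>
    (Complex.continuous_ofReal.comp_continuousOn hfc).mul (continuousOn_loopIntegral_pp_level hA hd hlo hhi ϑ θ hhi0 hhir hKc0)
  have hF'cont : ContinuousOn (fun e => F' θ₀ e) (Icc (-hi) hi) :=
    (Complex.continuous_ofReal.comp_continuousOn hfc).mul
      (Complex.continuous_ofReal.comp_continuousOn (continuousOn_firstOrderLine_level hA hd hlo hhi ϑ θ₀ hhi0 hhir hKc))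
  have hmeas : ∀ θ, AEStronglyMeasurable (fun e => F θ e) (volume.restrict (Ι (-hi) hi)) := fun θ => by
    rw [uIoc_of_le hhh]
    exact ((hFcont θ).mono Ioc_subset_Icc_self).aestronglyMeasurable measurableSet_Ioc
  have hF_meas : ∀ᶠ θ in 𝓝 θ₀, AEStronglyMeasurable (fun e => F θ e) (volume.restrict (Ι (-hi) hi)) := Eventually.of_forall hmeas
  have hF_int : IntervalIntegrable (fun e => F θ₀ e) volume (-hi) hi :=
    ((hFcont θ₀).mono (by rw [uIcc_of_le hhh])).intervalIntegrable
  have hF'_meas : AEStronglyMeasurable (fun e => F' θ₀ e) (volume.restrict (Ι (-hi) hi)) := by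
    rw [uIoc_of_le hhh]
    exact (hF'cont.mono Ioc_subset_Icc_self).aestronglyMeasurable measurableSet_Ioc
  -- the constant dominator
  have hJ0 : ∀ e ∈ Icc (-hi) hi, ∀ s, |levelChartJac μ K (e, s)| ≤ klJacG B₀.Dtmin A A₃ 0 := fun e he s => by
    have he1 := (abs_lt.1 (hIcc_r e he)).1
    have he2 := (abs_lt.1 (hIcc_r e he)).2
    exact abs_levelChartJac_le' B₀ hA hADt (μ := μ) (ρ := e) (by linarith) (by linarith) A₃ s
  have hS₁ : ∀ θ, ‖iteratedDeriv 1 (levelPoint μ K 0) θ + iteratedDeriv 1 (levelPoint μ K ρ) (ϑ + θ)‖ ≤ msD A₃ A₄ 1 + msD A₃ A₄ 1 := fun θ =>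
    (norm_add_le _ _).trans (add_le_add (norm_iteratedDeriv_levelPoint_le hA hA20 hd hlo hhi hA₃ hA₄ h0r le_rfl (by norm_num) θ)
      (norm_iteratedDeriv_levelPoint_le hA hA20 hd hlo hhi hA₃ hA₄ hρ le_rfl (by norm_num) (ϑ + θ)))
  have hJ00 : 0 ≤ klJacG B₀.Dtmin A A₃ 0 := (abs_nonneg _).trans (hJ0 0 ⟨by linarith, hhi0⟩ 0)
  have hK10 : 0 ≤ K₁ := (norm_nonneg _).trans (hK₁ 0)
  have hS0 : 0 ≤ msD A₃ A₄ 1 + msD A₃ A₄ 1 := (norm_nonneg _).trans (hS₁ 0)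
  have hM10 : 0 ≤ M₁ := (abs_nonneg _).trans (hK1 0 ⟨by linarith, hhi0⟩ 0)
  have hW0 : 0 ≤ W := (abs_nonneg _).trans (hfW 0 ⟨by linarith, hhi0⟩)
  have hLb : ∀ θ, ∀ e ∈ Icc (-hi) hi, |L θ e| ≤ 2 * π * (klJacG B₀.Dtmin A A₃ 0 * (K₁ * (msD A₃ A₄ 1 + msD A₃ A₄ 1)) * M₁) := fun θ e he => by
    have hb : ∀ v ∈ Ι (-π) π, ‖levelChartJac μ K (e, v + θ) *
        (fderiv ℝ (frameLevel μ K) (pairSumPath μ K ρ ϑ θ 0 - levelPoint μ K e (v + θ)))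
          (iteratedDeriv 1 (levelPoint μ K 0) θ + iteratedDeriv 1 (levelPoint μ K ρ) (ϑ + θ)) *
        deriv (Kr e) (frameLevel μ K (pairSumPath μ K ρ ϑ θ 0 - levelPoint μ K e (v + θ)))‖ ≤
        klJacG B₀.Dtmin A A₃ 0 * (K₁ * (msD A₃ A₄ 1 + msD A₃ A₄ 1)) * M₁ := fun v _ => by
      rw [Real.norm_eq_abs, abs_mul, abs_mul]
      have hG : |(fderiv ℝ (frameLevel μ K) (pairSumPath μ K ρ ϑ θ 0 - levelPoint μ K e (v + θ)))
          (iteratedDeriv 1 (levelPoint μ K 0) θ + iteratedDeriv 1 (levelPoint μ K ρ) (ϑ + θ))| ≤ K₁ * (msD A₃ A₄ 1 + msD A₃ A₄ 1) := by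
        rw [← Real.norm_eq_abs]
        exact (ContinuousLinearMap.le_opNorm _ _).trans (mul_le_mul (hK₁ _) (hS₁ θ) (norm_nonneg _) hK10)
      exact mul_le_mul (mul_le_mul (hJ0 e he _) hG (abs_nonneg _) hJ00) (hK1 e he _) (abs_nonneg _) (mul_nonneg hJ00 (mul_nonneg hK10 hS0))
    have h := intervalIntegral.norm_integral_le_of_norm_le_const hb
    rw [Real.norm_eq_abs, show π - -π = 2 * π by ring, abs_of_pos (by positivity : (0 : ℝ) < 2 * π)] at h
    simp only [hLdef]
    linarith [h]
  have h_bound : ∀ᵐ e ∂volume, e ∈ Ι (-hi) hi → ∀ θ ∈ (univ : Set ℝ),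
      ‖F' θ e‖ ≤ W * (2 * π * (klJacG B₀.Dtmin A A₃ 0 * (K₁ * (msD A₃ A₄ 1 + msD A₃ A₄ 1)) * M₁)) := by
    refine Eventually.of_forall fun e he θ _ => ?_
    have he' : e ∈ Icc (-hi) hi := by rw [uIoc_of_le hhh] at he; exact ⟨he.1.le, he.2⟩
    simp only [hF'def, norm_mul, Complex.norm_real, Real.norm_eq_abs]
    exact mul_le_mul (hfW e he') (hLb θ e he') (abs_nonneg _) hW0
  have bound_integrable : IntervalIntegrable (fun _ : ℝ => W * (2 * π * (klJacG B₀.Dtmin A A₃ 0 * (K₁ * (msD A₃ A₄ 1 + msD A₃ A₄ 1)) * M₁)))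
      volume (-hi) hi := intervalIntegrable_const
  have hmain := (intervalIntegral.hasDerivAt_integral_of_dominated_loc_of_deriv_le (univ_mem) hF_meas hF_int hF'_meas h_bound
    bound_integrable h_diff).2
  -- identify the derivative value
  have hval : (∫ e in (-hi)..hi, F' θ₀ e) = (((∫ e in (-hi)..hi, f e * L θ₀ e : ℝ)) : ℂ) := by
    simp only [hF'def, ← Complex.ofReal_mul]
    exact intervalIntegral.integral_ofReal
  rw [hval] at hmain
  exact hmain

/-- **… and its norm** = the level box of `firstOrderLayer_abs_le` / `farPartner_firstOrderLayer_abs_le` with weight `f` and kernel family `K e`. -/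
theorem norm_deriv_tubePiece_joint_eq {f : ℝ → ℝ} {hi W : ℝ} (hhi0 : 0 ≤ hi) (hhir : hi < r) (hfc : ContinuousOn f (Icc (-hi) hi))
    (hfW : ∀ e ∈ Icc (-hi) hi, |f e| ≤ W)
    {Kr : ℝ → ℝ → ℝ} (hKd : ∀ e ∈ Icc (-hi) hi, ContDiff ℝ 2 (Kr e)) (hKc0 : Continuous fun p : ℝ × ℝ => Kr p.1 p.2)
    (hKc : Continuous fun p : ℝ × ℝ => deriv (Kr p.1) p.2) {M₀ M₁ : ℝ} (hK0 : ∀ e ∈ Icc (-hi) hi, ∀ u, |Kr e u| ≤ M₀)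
    (hK1 : ∀ e ∈ Icc (-hi) hi, ∀ u, |deriv (Kr e) u| ≤ M₁) {ρ : ℝ} (hρ : |ρ| < r) (ϑ θ₀ : ℝ) :
    ‖deriv (fun θ : ℝ => ∫ e in (-hi)..hi, ((f e : ℝ) : ℂ) * ∫ φ in Ioo (-π) π,
        (levelChartJac μ K (e, φ + θ) : ℝ) • ((Kr e (frameLevel μ K (levelPoint μ K 0 θ + levelPoint μ K ρ (ϑ + θ) - levelPoint μ K e (φ + θ))) : ℝ) : ℂ)) θ₀‖ =
      |∫ e in (-hi)..hi, f e * ∫ v in (-π)..π, levelChartJac μ K (e, v + θ₀) *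
          (fderiv ℝ (frameLevel μ K) (pairSumPath μ K ρ ϑ θ₀ 0 - levelPoint μ K e (v + θ₀)))
            (iteratedDeriv 1 (levelPoint μ K 0) θ₀ + iteratedDeriv 1 (levelPoint μ K ρ) (ϑ + θ₀)) *
        deriv (Kr e) (frameLevel μ K (pairSumPath μ K ρ ϑ θ₀ 0 - levelPoint μ K e (v + θ₀)))| := by
  rw [(hasDerivAt_tubePiece_joint hA hA20 hd hr hlo hhi hA₃ hA₄ hK₁ hhi0 hhir hfc hfW hKd hKc0 hKc hK0 hK1 hρ ϑ θ₀).deriv, Complex.norm_real,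
    Real.norm_eq_abs]

end Sizes

end Summit.HubbardSuperconductivity.HubbardSuperconductivity.Theorems.C4a

end
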